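import Literature.Algebra.Polynomial.ShefferSequences
import Mathlib.Tactic
import HarnessLib

/-!
# Bernoulli polynomials as `J^{−1} x^n` and the Euler polynomials `[I + Δ/2]^{−1} x^n`
# (Rota–Kahaner–Odlyzko §13)

G.-C. Rota, D. Kahaner, A. Odlyzko, *Finite operator calculus* (1973), §13, pp. 737–738:

> By far the most widely studied class of Appell polynomials are the Bernoulli polynomials (see
> Nörlund). They correspond to the operator `J^α`, where `J p (x) = ∫_x^{x+1} p (t) dt`. (Since
> `D J = Δ`, `J^α` is also defined by `J^α = (Δ/D)^α = [(e^D − 1)/D]^α`.) For `α = 1`, we have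
> `J^{−1} x^n = B_n (x)`, the familiar Bernoulli polynomials … generalizations (Nörlund) are
> obtained by taking the `B_n^{(α)} (x) = J^{−α} x^n`. …
> Another extensively studied (by Nörlund) class of Appell polynomials is
> `E_n^{(a)} (x) = [I + (Δ/2)]^{−a} x^n`, … These sequences are variously called "Euler polynomials" …

Over a field `K` of characteristic `0`: `J^{−1} = D/(e^D − 1)` is `diffOp (bernoulliPowerSeries K)`
(Mathlib: `bernoulliPowerSeries A * (exp A − 1) = X`), so `B_n = J^{−1} x^n` identifies Mathlib's
Bernoulli polynomials (`Polynomial.bernoulli n : ℚ[X]`, mapped to `K[X]`) with the operator-calculus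
ones; `J = diffOp (bernoulliPowerSeries K)⁻¹ = ((e^D − 1)/D)` satisfies `D J = Δ` and `J B_n = x^n`;
the Nörlund polynomials `B_n^{(a)} = J^{−a} x^n` (`a : ℕ`). The **Euler polynomials** (absent from
Mathlib; unrelated to the Euler factors `ArtinRep.eulerPolynomial`,
`Literature.NumberTheory.Automorphic.eulerPolynomial` elsewhere in the tree) are DEFINED
as `E_n^{(a)} = [I + Δ/2]^{−a} x^n = 2^a (e^D + I)^{−a} x^n`, `E_n = E_n^{(1)}`:
`E_n (x+1) + E_n (x) = 2 x^n`, Appell, `E_0 = 1`, `E_1 = x − 1/2`, `E_2 = x² − x`.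
-- TODO(general form): non-integral orders `α`, `a` (powers `J^α`).

## References
* [RotaKahanerOdlyzko1973] G.-C. Rota, D. Kahaner, A. Odlyzko, *On the foundations of
  combinatorial theory VIII. Finite operator calculus*, J. Math. Anal. Appl. 42 (1973) 684–760,
  §13, pp. 737–738.
* [Robert2000PadicAnalysis] A. M. Robert, *A Course in p-adic Analysis*, GTM 198, Springer (2000),
  Ch. IV §5.1 Examples (3) (`e^D − 1 = ∇`) and §6.1 (Appell sequences), pp. 196, 205.
-/

noncomputable section

open Polynomial Finset

namespace Literature.Algebra.Polynomial

variable (K : Type*) [Field K] [CharZero K]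

/-! ## `J^{−1} = D/(e^D − 1)` and the Bernoulli polynomials -/

/-- `D/(e^D − 1) = Σ b_k D^k/k!` has constant term `b_0 = 1`.
[cite: RotaKahanerOdlyzko1973, §13, p. 737] -/
theorem constantCoeff_bernoulliPowerSeries :
    PowerSeries.constantCoeff (bernoulliPowerSeries K) = 1 := by
  rw [← PowerSeries.coeff_zero_eq_constantCoeff_apply, bernoulliPowerSeries, PowerSeries.coeff_mk,
    _root_.bernoulli_zero, Nat.factorial_zero, Nat.cast_one, div_one, map_one]

/-- `D/(e^D − 1)` is invertible in `K[[t]]`. [cite: RotaKahanerOdlyzko1973, §13, p. 737] -/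
theorem constantCoeff_bernoulliPowerSeries_ne_zero :
    PowerSeries.constantCoeff (bernoulliPowerSeries K) ≠ 0 := by
  rw [constantCoeff_bernoulliPowerSeries]
  exact one_ne_zero

/-- **`J = (e^D − 1)/D`**: `t · (t/(e^t − 1))^{−1} = e^t − 1`.
[cite: RotaKahanerOdlyzko1973, §13 ("`J = (Δ/D) = (e^D − 1)/D`"), p. 737] -/
theorem X_mul_bernoulliPowerSeries_inv :
    PowerSeries.X * (bernoulliPowerSeries K)⁻¹ = PowerSeries.exp K - 1 :=
  ((PowerSeries.eq_mul_inv_iff_mul_eq (constantCoeff_bernoulliPowerSeries_ne_zero K)).2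
    (by rw [mul_comm, bernoulliPowerSeries_mul_exp_sub_one])).symm

/-- **`D J = Δ`** (`J p (x) = ∫_x^{x+1} p (t) dt` differentiates to `p (x+1) − p (x)`):
`D ∘ J = τ_1 − I` for `J = ((e^D − 1)/D)`. [cite: RotaKahanerOdlyzko1973, §13 ("since `DJ = Δ`"),
p. 737] [cite: Robert2000PadicAnalysis, Ch. IV §5.1 Examples (3), p. 196] -/
theorem derivative_comp_diffOp_bernoulliPowerSeries_inv :
    (derivative ∘ₗ diffOp (bernoulliPowerSeries K)⁻¹ : K[X] →ₗ[K] K[X]) = taylor (1 : K) - LinearMap.id := by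
  rw [derivative_comp_diffOp_eq, X_mul_bernoulliPowerSeries_inv, diffOp_exp_sub_one]

/-- **`B_n (x) = J^{−1} x^n = (D/(e^D − 1)) x^n`** — Mathlib's Bernoulli polynomials
`B_n = Σ_k C(n,k) b_k x^{n−k}` (over `ℚ`, mapped to `K`) are the composition operator
`Σ_k b_k D^k/k!` applied to `x^n`. [cite: RotaKahanerOdlyzko1973, §13 ("for `α = 1`, we have
`J^{−1} x^n = B_n (x)`, the familiar Bernoulli polynomials"), p. 737] -/
theorem bernoulli_map_eq_diffOp_X_pow (n : ℕ) :
    (Polynomial.bernoulli n).map (algebraMap ℚ K) = diffOp (bernoulliPowerSeries K) (X ^ n) := by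
  rw [diffOp_apply_X_pow, Polynomial.bernoulli, Polynomial.map_sum]
  refine sum_congr rfl fun k _ => ?_
  have hk0 : (k.factorial : K) ≠ 0 := Nat.cast_ne_zero.2 (Nat.factorial_ne_zero k)
  rw [Polynomial.map_monomial, bernoulliPowerSeries, PowerSeries.coeff_mk, smul_X_eq_monomial, map_mul,
    map_natCast, map_div₀, map_natCast, Nat.descFactorial_eq_factorial_mul_choose, Nat.cast_mul,
    div_mul_eq_mul_div, mul_comm (k.factorial : K) _, ← mul_assoc, mul_div_assoc, div_self hk0, mul_one]

/-- **`J B_n = x^n`** (`∫_x^{x+1} B_n (t) dt = x^n`). [cite: RotaKahanerOdlyzko1973, §13, p. 737] -/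
theorem diffOp_bernoulliPowerSeries_inv_bernoulli_map (n : ℕ) :
    diffOp (bernoulliPowerSeries K)⁻¹ ((Polynomial.bernoulli n).map (algebraMap ℚ K)) = X ^ n := by
  rw [bernoulli_map_eq_diffOp_X_pow, ← LinearMap.comp_apply,
    diffOp_inv_comp_diffOp (constantCoeff_bernoulliPowerSeries_ne_zero K), LinearMap.id_apply]

/-- Consequence (`Δ = D J`): `B_n (x + 1) − B_n (x) = D x^n` (consistent with Mathlib's
`Polynomial.bernoulli_comp_one_add_X`). [cite: RotaKahanerOdlyzko1973, §13, p. 737] -/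
theorem taylor_one_bernoulli_map_sub (n : ℕ) :
    taylor (1 : K) ((Polynomial.bernoulli n).map (algebraMap ℚ K)) -
        (Polynomial.bernoulli n).map (algebraMap ℚ K) = derivative (X ^ n) := by
  have h := congrArg (fun T : K[X] →ₗ[K] K[X] => T ((Polynomial.bernoulli n).map (algebraMap ℚ K)))
    (derivative_comp_diffOp_bernoulliPowerSeries_inv K)
  simp only [LinearMap.comp_apply, LinearMap.sub_apply, LinearMap.id_apply] at h
  rw [← h, diffOp_bernoulliPowerSeries_inv_bernoulli_map]

/-! ## The Nörlund polynomials `B_n^{(a)} = J^{−a} x^n` -/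

/-- **The Bernoulli polynomials of (natural) order `a`**: `B_n^{(a)} = J^{−a} x^n`
(Nörlund; `a = 1` gives `B_n`, `a = 0` gives `x^n`). [cite: RotaKahanerOdlyzko1973, §13
("generalizations (Nörlund) are obtained by taking the `B_n^{(α)} (x) = J^{−α} x^n`"), p. 737] -/
def bernoulliHigher (a n : ℕ) : K[X] :=
  diffOp (bernoulliPowerSeries K ^ a) (X ^ n)

/-- Unfolding `B_n^{(a)} = (J^{−1})^a x^n`. [cite: RotaKahanerOdlyzko1973, §13, p. 737] -/
theorem bernoulliHigher_eq (a n : ℕ) :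
    bernoulliHigher K a n = diffOp (bernoulliPowerSeries K ^ a) (X ^ n) :=
  rfl

/-- `B_n^{(0)} = x^n`. [cite: RotaKahanerOdlyzko1973, §13, p. 737] -/
theorem bernoulliHigher_zero_left (n : ℕ) : bernoulliHigher K 0 n = X ^ n := by
  rw [bernoulliHigher_eq, pow_zero, diffOp_one, LinearMap.id_apply]

/-- `B_n^{(1)} = B_n`. [cite: RotaKahanerOdlyzko1973, §13, p. 737] -/
theorem bernoulliHigher_one_left (n : ℕ) :
    bernoulliHigher K 1 n = (Polynomial.bernoulli n).map (algebraMap ℚ K) := by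
  rw [bernoulliHigher_eq, pow_one, bernoulli_map_eq_diffOp_X_pow]

/-- `J B_n^{(a+1)} = B_n^{(a)}`. [cite: RotaKahanerOdlyzko1973, §13, p. 737] -/
theorem diffOp_bernoulliPowerSeries_inv_bernoulliHigher_succ (a n : ℕ) :
    diffOp (bernoulliPowerSeries K)⁻¹ (bernoulliHigher K (a + 1) n) = bernoulliHigher K a n := by
  rw [bernoulliHigher_eq, bernoulliHigher_eq, ← LinearMap.comp_apply, ← diffOp_mul, pow_succ',
    ← mul_assoc, PowerSeries.inv_mul_cancel _ (constantCoeff_bernoulliPowerSeries_ne_zero K), one_mul]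

/-- **`(B_n^{(a)})_n` is an Appell sequence** ("Appell polynomials").
[cite: RotaKahanerOdlyzko1973, §13, p. 737] [cite: Robert2000PadicAnalysis, Ch. IV §6.1, p. 205] -/
theorem isAppellSequence_bernoulliHigher (a : ℕ) : IsAppellSequence (bernoulliHigher K a) :=
  isBasicSequence_derivative_X_pow.isShefferSequence_map isDeltaOperator_derivative
    (isShiftInvariant_diffOp _) (by
      rw [diffOp_apply_one, map_pow, constantCoeff_bernoulliPowerSeries, one_pow, C_1]
      exact one_ne_zero)

/-- Appell's identity for `B_n^{(a)}`: `B_n^{(a)} (x + y) = Σ_k C(n,k) x^k B_{n−k}^{(a)} (y)`.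
[cite: RotaKahanerOdlyzko1973, §13, p. 737] [cite: Robert2000PadicAnalysis, Ch. IV §6.1 (S), p. 205] -/
theorem bernoulliHigher_eval_add (a n : ℕ) (x y : K) :
    (bernoulliHigher K a n).eval (x + y) =
      ∑ k ∈ range (n + 1), (n.choose k : K) * x ^ k * (bernoulliHigher K a (n - k)).eval y :=
  (isAppellSequence_bernoulliHigher K a).eval_add n x y

/-! ## The Euler polynomials `E_n = [I + Δ/2]^{−1} x^n` -/

/-- **`e^D + I = τ_1 + I`** (so `I + Δ/2 = ½ (e^D + I)`).
[cite: RotaKahanerOdlyzko1973, §13, p. 737] [cite: Robert2000PadicAnalysis, Ch. IV §5.1 Examples (3),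
p. 196] -/
theorem diffOp_exp_add_one :
    diffOp (PowerSeries.exp K + 1) = (taylor (1 : K) + LinearMap.id : K[X] →ₗ[K] K[X]) := by
  rw [diffOp_add, diffOp_one, taylor_eq_diffOp_exp, PowerSeries.rescale_one, RingHom.id_apply]

/-- `e^t + 1` has constant term `2 ≠ 0`. [cite: RotaKahanerOdlyzko1973, §13, p. 737] -/
theorem constantCoeff_exp_add_one : PowerSeries.constantCoeff (PowerSeries.exp K + 1) = 2 := by
  rw [map_add, PowerSeries.constantCoeff_exp, map_one, one_add_one_eq_two]

/-- `e^t + 1` is invertible in characteristic `0`. [cite: RotaKahanerOdlyzko1973, §13, p. 737] -/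
theorem constantCoeff_exp_add_one_ne_zero : PowerSeries.constantCoeff (PowerSeries.exp K + 1) ≠ 0 := by
  rw [constantCoeff_exp_add_one]
  exact two_ne_zero

/-- **The Euler polynomials of (natural) order `a`**: `E_n^{(a)} = [I + Δ/2]^{−a} x^n
= 2^a (e^D + I)^{−a} x^n` (Nörlund, as quoted by Rota–Kahaner–Odlyzko).
[cite: RotaKahanerOdlyzko1973, §13 ("`E_n^{(a)} (x) = [I + (Δ/2)]^{−a} x^n`"), p. 737] -/
def eulerHigher (a n : ℕ) : K[X] :=
  diffOp ((2 : K) ^ a • (PowerSeries.exp K + 1)⁻¹ ^ a) (X ^ n)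

/-- **The Euler polynomials** `E_n = E_n^{(1)} = [I + Δ/2]^{−1} x^n` (the classical
`Σ E_n (x) t^n/n! = 2 e^{xt}/(e^t + 1)`). [cite: RotaKahanerOdlyzko1973, §13, pp. 737–738] -/
def eulerPolynomial (n : ℕ) : K[X] :=
  eulerHigher K 1 n

/-- Unfolding `E_n^{(a)} = (2^a (e^t + 1)^{−a})(D) x^n`. [cite: RotaKahanerOdlyzko1973, §13, p. 737] -/
theorem eulerHigher_eq (a n : ℕ) :
    eulerHigher K a n = diffOp ((2 : K) ^ a • (PowerSeries.exp K + 1)⁻¹ ^ a) (X ^ n) :=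
  rfl

/-- `E_n^{(a)} = [I + Δ/2]^{−a} x^n` literally: `(½ (e^t + 1))^{−1}` to the power `a`, applied to
`x^n`. [cite: RotaKahanerOdlyzko1973, §13, p. 737] -/
theorem eulerHigher_eq_diffOp_inv_pow (a n : ℕ) :
    eulerHigher K a n = diffOp ((((2⁻¹ : K) • (PowerSeries.exp K + 1))⁻¹) ^ a) (X ^ n) := by
  rw [eulerHigher_eq, PowerSeries.smul_inv, inv_inv, smul_pow]

/-- Unfolding `E_n = (2 (e^t + 1)^{−1})(D) x^n`. [cite: RotaKahanerOdlyzko1973, §13, p. 737] -/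
theorem eulerPolynomial_eq (n : ℕ) :
    eulerPolynomial K n = diffOp ((2 : K) • (PowerSeries.exp K + 1)⁻¹) (X ^ n) := by
  rw [eulerPolynomial, eulerHigher_eq, pow_one, pow_one]

/-- `E_n^{(0)} = x^n`. [cite: RotaKahanerOdlyzko1973, §13, p. 737] -/
theorem eulerHigher_zero_left (n : ℕ) : eulerHigher K 0 n = X ^ n := by
  rw [eulerHigher_eq, pow_zero, pow_zero, one_smul, diffOp_one, LinearMap.id_apply]

/-- `(e^D + I) E_n^{(a+1)} = 2 E_n^{(a)}`, i.e. `[I + Δ/2] E_n^{(a+1)} = E_n^{(a)}`.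
[cite: RotaKahanerOdlyzko1973, §13, p. 737] -/
theorem diffOp_exp_add_one_eulerHigher_succ (a n : ℕ) :
    diffOp (PowerSeries.exp K + 1) (eulerHigher K (a + 1) n) = (2 : K) • eulerHigher K a n := by
  rw [eulerHigher_eq, eulerHigher_eq, ← LinearMap.comp_apply, ← diffOp_mul, ← LinearMap.smul_apply,
    ← diffOp_smul, mul_smul_comm, pow_succ' (PowerSeries.exp K + 1)⁻¹ a, ← mul_assoc,
    PowerSeries.mul_inv_cancel _ (constantCoeff_exp_add_one_ne_zero K), one_mul, pow_succ' (2 : K) a,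
    mul_smul]

/-- **`E_n (x + 1) + E_n (x) = 2 x^n`** (`[I + Δ/2] E_n = x^n`), as polynomials.
[cite: RotaKahanerOdlyzko1973, §13, p. 737] -/
theorem taylor_one_eulerPolynomial_add (n : ℕ) :
    taylor (1 : K) (eulerPolynomial K n) + eulerPolynomial K n = (2 : K) • X ^ n := by
  have h := diffOp_exp_add_one_eulerHigher_succ K 0 n
  rw [zero_add, eulerHigher_zero_left, diffOp_exp_add_one, LinearMap.add_apply, LinearMap.id_apply] at h
  exact h

/-- `E_n (x + 1) + E_n (x) = 2 x^n`, evaluated. [cite: RotaKahanerOdlyzko1973, §13, p. 737] -/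
theorem eulerPolynomial_eval_add_one_add (n : ℕ) (x : K) :
    (eulerPolynomial K n).eval (x + 1) + (eulerPolynomial K n).eval x = 2 * x ^ n := by
  have h := congrArg (eval x) (taylor_one_eulerPolynomial_add K n)
  rwa [eval_add, taylor_eval, eval_smul, eval_pow, eval_X, smul_eq_mul] at h

/-- **`(E_n^{(a)})_n` is an Appell sequence.** [cite: RotaKahanerOdlyzko1973, §13 ("another
extensively studied class of Appell polynomials"), p. 737] [cite: Robert2000PadicAnalysis,
Ch. IV §6.1, p. 205] -/
theorem isAppellSequence_eulerHigher (a : ℕ) : IsAppellSequence (eulerHigher K a) :=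
  isBasicSequence_derivative_X_pow.isShefferSequence_map isDeltaOperator_derivative
    (isShiftInvariant_diffOp _) (by
      rw [diffOp_apply_one, PowerSeries.smul_eq_C_mul, map_mul, PowerSeries.constantCoeff_C, map_pow,
        PowerSeries.constantCoeff_inv, constantCoeff_exp_add_one, ← mul_pow,
        mul_inv_cancel₀ (two_ne_zero' K), one_pow, C_1]
      exact one_ne_zero)

/-- **The Euler polynomials form an Appell sequence**: `E_n' = n E_{n−1}`, `deg E_n = n`.
[cite: RotaKahanerOdlyzko1973, §13, p. 737] -/
theorem isAppellSequence_eulerPolynomial : IsAppellSequence (eulerPolynomial K) :=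
  isAppellSequence_eulerHigher K 1

/-- `E_{n+1}' = (n+1) E_n`. [cite: RotaKahanerOdlyzko1973, §13, p. 737] -/
theorem derivative_eulerPolynomial_succ (n : ℕ) :
    derivative (eulerPolynomial K (n + 1)) = ((n + 1 : ℕ) : K) • eulerPolynomial K n :=
  (isAppellSequence_eulerPolynomial K).map_succ n

/-- Appell's identity `E_n (x + y) = Σ_k C(n,k) x^k E_{n−k} (y)`.
[cite: RotaKahanerOdlyzko1973, §13, p. 737] [cite: Robert2000PadicAnalysis, Ch. IV §6.1 (S), p. 205] -/
theorem eulerPolynomial_eval_add (n : ℕ) (x y : K) :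
    (eulerPolynomial K n).eval (x + y) =
      ∑ k ∈ range (n + 1), (n.choose k : K) * x ^ k * (eulerPolynomial K (n - k)).eval y :=
  (isAppellSequence_eulerPolynomial K).eval_add n x y

/-- **`E_n` is characterised by `q (x+1) + q (x) = 2 x^n`** (`e^D + I` is invertible).
[cite: RotaKahanerOdlyzko1973, §13, p. 737] -/
theorem eulerPolynomial_eq_of_taylor_one_add {n : ℕ} {q : K[X]}
    (hq : taylor (1 : K) q + q = (2 : K) • X ^ n) : eulerPolynomial K n = q := by
  apply (diffOp_bijective (constantCoeff_exp_add_one_ne_zero K)).1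
  rw [diffOp_exp_add_one, LinearMap.add_apply, LinearMap.id_apply, taylor_one_eulerPolynomial_add,
    LinearMap.add_apply, LinearMap.id_apply, hq]

/-- `E_0 = 1`. [cite: RotaKahanerOdlyzko1973, §13, p. 737] -/
theorem eulerPolynomial_zero : eulerPolynomial K 0 = 1 :=
  eulerPolynomial_eq_of_taylor_one_add K (by rw [taylor_one, C_1, pow_zero, two_smul])

/-- `E_1 = x − 1/2`. [cite: RotaKahanerOdlyzko1973, §13, p. 737] -/
theorem eulerPolynomial_one : eulerPolynomial K 1 = X - C (2⁻¹ : K) :=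
  eulerPolynomial_eq_of_taylor_one_add K (by
    rw [map_sub, taylor_X, taylor_C, pow_one, two_smul]
    have h2 : (C (2⁻¹ : K) : K[X]) + C (2⁻¹ : K) = C 1 := by
      rw [← C_add]; norm_num
    linear_combination (-1 : K[X]) * h2)

/-- `E_2 = x² − x`. [cite: RotaKahanerOdlyzko1973, §13, p. 737] -/
theorem eulerPolynomial_two : eulerPolynomial K 2 = X ^ 2 - X :=
  eulerPolynomial_eq_of_taylor_one_add K (by
    rw [map_sub, taylor_pow, taylor_X, C_1, two_smul]
    ring)

end Literature.Algebra.Polynomial
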